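import Mathlib
import Literature.Computability.AlgebraicComplexity.DeterminantalComplexity
import Literature.Computability.AlgebraicComplexity.LRPencilOfMatrix
import Literature.Computability.AlgebraicComplexity.DeterminantalConormalBoundProofs
import Literature.Computability.AlgebraicComplexity.StandardFamilies
import Summits.ValiantsHypothesis.ValiantsHypothesis.Theses.RefutationDegree

/-!
# The Euler–Jacobi trace identity `tr(adj A · A(0)) = (m - d) · det A` (line `Sketch`, crux `BeyondHessianNs`)

Helper file for crux item stmt-ValiantsHypothesis-5641 (`RefutationDegree.BeyondHessianNs`).

For an `m × m` matrix `A = A₀ + Σ_e x_e A_e` of AFFINE linear forms whose determinant is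
homogeneous of degree `d`, Euler's identity `Σ_e x_e ∂_e det A = d · det A` and Jacobi's formula
`∂_e det A = tr(adj A · A_e)` combine with `Σ_e x_e A_e = A - A₀` and `tr(adj A · A) = m · det A` to
the polynomial identity

  `tr(adj A · A₀) = (m - d) · det A`                                                    (E)

(card `kernel-pair-confinement`, identity (E) / `TraceAdjugateConstPart`).  Consequences recorded
here: at a zero `x` of `det A`, `tr(adj A(x) · A₀) = 0`, so every kernel pair `(c, v)` of a
corank-one value `A(x)` satisfies `cᵀ A₀ v = 0`; and for the permanent (`d = n`, `m ≠ n`) the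
identity (E) is an explicit degree-`m` element of the ideal of `Rep(n,m)` — the first-order (in
`A₀`) identity the line adds to the Mignon–Ressayre Hessian-minor identities.
-/

noncomputable section

-- `Summit.ValiantsHypothesis.ValiantsHypothesis.…` is the tree's mandated single-conjunct layout.
set_option linter.dupNamespace false

namespace Summit.ValiantsHypothesis.ValiantsHypothesis.Theorems.RefutationDegreeBeyondHessianNs

open MvPolynomial Matrix
open Literature.Computability.AlgebraicComplexity

section General

variable {R : Type*} [CommRing R] {σ : Type*} [Fintype σ]

/-- Euler's identity in degree `≤ 1`: `Σ_e x_e ∂_e p = p - p(0)` for an affine linear form `p`.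
[folklore] -/
theorem sum_X_mul_pderiv_of_totalDegree_le_one {p : MvPolynomial σ R} (hp : p.totalDegree ≤ 1) :
    ∑ e, X e * pderiv e p = p - C (constantCoeff p) := by
  classical
  have h := LRPencil.eq_affine_of_totalDegree_le_one p hp
  rw [eq_sub_iff_add_eq, add_comm]
  conv_rhs => rw [h]
  rw [constantCoeff_eq]
  congr 1
  refine Finset.sum_congr rfl fun e _ => ?_
  rw [DeterminantalConormal.pderiv_eq_C_coeff_of_totalDegree_le_one hp, mul_comm]

/-- Matrix form: `Σ_e x_e • ∂_e A = A - A(0)` entrywise for a matrix of affine linear forms.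
[folklore] -/
theorem sum_X_smul_map_pderiv {ι : Type*} (A : Matrix ι ι (MvPolynomial σ R))
    (hA : ∀ i j, (A i j).totalDegree ≤ 1) :
    ∑ e, (X e : MvPolynomial σ R) • A.map (pderiv e) = A - (constPart A).map C := by
  apply Matrix.ext
  intro i j
  simp only [Matrix.sum_apply, Matrix.smul_apply, Matrix.map_apply, smul_eq_mul, Matrix.sub_apply,
    constPart_apply]
  exact sum_X_mul_pderiv_of_totalDegree_le_one (hA i j)

/-- **The Euler–Jacobi trace identity** (E): for an `m × m` matrix `A` of affine linear forms with
`det A` homogeneous of degree `d`, `tr(adj A · A(0)) = (m - d) · det A`. [folklore] -/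
theorem trace_adjugate_mul_constPart {m d : ℕ} (A : Matrix (Fin m) (Fin m) (MvPolynomial σ R))
    (hA : ∀ i j, (A i j).totalDegree ≤ 1) (hhom : A.det.IsHomogeneous d) :
    (A.adjugate * (constPart A).map C).trace = ((m : MvPolynomial σ R) - d) * A.det := by
  classical
  have hE := hhom.sum_X_mul_pderiv
  have hJ : ∀ e : σ, pderiv e A.det = (A.adjugate * A.map (pderiv e)).trace := fun e =>
    DeterminantalConormal.derivation_det_eq_trace_adjugate_mul (pderiv e) A
  have h1 : (A.adjugate * (A - (constPart A).map C)).trace = (d : MvPolynomial σ R) * A.det := by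
    rw [← sum_X_smul_map_pderiv A hA, Matrix.mul_sum, Matrix.trace_sum]
    have : ∀ e : σ, (A.adjugate * ((X e : MvPolynomial σ R) • A.map (pderiv e))).trace
        = X e * pderiv e A.det := fun e => by
      rw [Matrix.mul_smul, Matrix.trace_smul, smul_eq_mul, hJ]
    rw [Finset.sum_congr rfl fun e _ => this e, hE, nsmul_eq_mul]
  have h2 : (A.adjugate * A).trace = (m : MvPolynomial σ R) * A.det := by
    rw [Matrix.adjugate_mul, Matrix.trace_smul, Matrix.trace_one, Fintype.card_fin, smul_eq_mul,
      mul_comm]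
  have h3 : (A.adjugate * (constPart A).map C).trace =
      (A.adjugate * A).trace - (A.adjugate * (A - (constPart A).map C)).trace := by
    rw [Matrix.mul_sub, Matrix.trace_sub]; ring
  rw [h3, h1, h2]; ring

/-- (E) evaluated at a zero: if `det A(x) = 0` then `tr(adj A(x) · A(0)) = 0`. [folklore] -/
theorem trace_adjugate_eval_mul_constPart_eq_zero {m d : ℕ}
    (A : Matrix (Fin m) (Fin m) (MvPolynomial σ R)) (hA : ∀ i j, (A i j).totalDegree ≤ 1)
    (hhom : A.det.IsHomogeneous d) (x : σ → R) (hx : eval x A.det = 0) :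
    ((A.map (eval x)).adjugate * constPart A).trace = 0 := by
  have h := congrArg (eval x) (trace_adjugate_mul_constPart A hA hhom)
  rw [map_mul, hx, mul_zero, AddMonoidHom.map_trace, Matrix.map_mul, ← RingHom.mapMatrix_apply,
    RingHom.map_adjugate, RingHom.mapMatrix_apply, Matrix.map_map] at h
  have hC : (constPart A).map (⇑(eval x) ∘ ⇑(C : R →+* MvPolynomial σ R)) = constPart A := by
    apply Matrix.ext
    intro i j
    simp
  rwa [hC] at h

/-- Kernel pairs are `A₀`-orthogonal: if `det A(x) = 0` and `adj A(x) = v cᵀ` (the corank-one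
situation, `cᵀ A(x) = 0 = A(x) v` up to scale) — more generally whenever `adj A(x)` is the outer
product `vecMulVec v c` — then `cᵀ A(0) v = 0`. [folklore] -/
theorem dotProduct_constPart_mulVec_eq_zero {m d : ℕ}
    (A : Matrix (Fin m) (Fin m) (MvPolynomial σ R)) (hA : ∀ i j, (A i j).totalDegree ≤ 1)
    (hhom : A.det.IsHomogeneous d) (x : σ → R) (hx : eval x A.det = 0) (v c : Fin m → R)
    (hadj : (A.map (eval x)).adjugate = vecMulVec v c) :
    c ⬝ᵥ (constPart A *ᵥ v) = 0 := by
  have h := trace_adjugate_eval_mul_constPart_eq_zero A hA hhom x hx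
  rw [hadj] at h
  rw [← h, Matrix.trace]
  simp only [Matrix.diag_apply, Matrix.mul_apply, vecMulVec_apply, dotProduct, Matrix.mulVec]
  rw [Finset.sum_comm]
  refine Finset.sum_congr rfl fun i _ => ?_
  rw [Finset.mul_sum]
  refine Finset.sum_congr rfl fun j _ => ?_
  ring

end General

/-! ### The permanent: (E) is an identity of `Rep(n, m)` -/

/-- **(E) for the permanent.** If `per_n = det A` with `A` an `m × m` matrix of affine linear
forms over `ℂ`, then `tr(adj A · A(0)) = (m - n) · per_n`; in particular, since `m ≥ n²/2 > n` for
`n ≥ 3` (Mignon–Ressayre), `A(0) ≠ 0`-information enters the ideal of `Rep(n, m)` at degree `m`.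
[folklore] -/
theorem trace_adjugate_mul_constPart_perPoly {n m : ℕ}
    (A : Matrix (Fin m) (Fin m) (MvPolynomial (Fin n × Fin n) ℂ))
    (hA : IsAffineDetRepr (perPoly (Fin n) ℂ) A) :
    (A.adjugate * (constPart A).map C).trace =
      ((m : MvPolynomial (Fin n × Fin n) ℂ) - n) * perPoly (Fin n) ℂ := by
  obtain ⟨hdeg, hdet⟩ := hA
  have hhom : A.det.IsHomogeneous n := by
    rw [hdet]
    simpa [Fintype.card_fin] using (perPoly_isHomogeneous (n := Fin n) (k := ℂ))
  rw [← hdet]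
  exact trace_adjugate_mul_constPart A hdeg hhom

end Summit.ValiantsHypothesis.ValiantsHypothesis.Theorems.RefutationDegreeBeyondHessianNs

end
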